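import Literature.MathematicalPhysics.QuantumFieldTheory.Balaban1983to89.Beta.RemainderHasMajH1kTowerPlaquette
import Literature.MathematicalPhysics.QuantumFieldTheory.Balaban1983to89.Beta.RemainderOriginTowerSliceGradClosed

/-!
# T. Bałaban, *The variational problem and background fields in renormalization group method for lattice gauge theories*, Commun. Math.
# Phys. **102** (1985) 277–309 [Balaban1985Variational] (182) p. 307, (190) p. 308, (129) p. 297, with [Balaban1985BackgroundPropagators] (3.35)–(3.37)
# p. 396, Thm 3.3 (3.42) pp. 397–399, Thm 3.11 p. 416, (3.126) p. 420, (3.132)–(3.133) p. 422, (3.137) p. 423 and [Balaban1985Averaging] Prop. 2 (52)–(54)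
# p. 26: **THE SLICE-GRADIENT LINE OF NODE D OF ROW (D4) AT THE ORIGIN ON NE9's TOWER — THE END ON PRINT's SMALL-FIELD CLASS (3.35)–(3.36): unitary values, bond variables
# `‖U(b) − 1‖ ≤ αη`, plaquette variables `‖U(∂p) − 1‖ ≤ αη²`, bond gradients `‖U(x,μ) − U(x − e_μ,μ)‖ ≤ αη²` — EVERY MODEL LETTER OF «Y5c» DERIVED,
# INCLUDING THE POSITIVITY OF `Δ_{a,k}(U)` AND `Δ′_{a′,k}(U)` ([5] Thm 3.11) AND THE REGULARITY DISPLAY OF `Q_k(U)` WITH ITS ONTO-THRESHOLD — «Y11» `Beta.RemainderOriginTowerSliceGradClosed` on print's class**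

CITATION HEADER (lean-in-tree rule 2026-08-18).  Sources: [Balaban1985Variational] (B11 = [15]; held `paper:balaban1985-cmp102-variational-background`, journal
page = PDF page + 276): (129) p. 297, (180) p. 306, (182) p. 307, (190) p. 308; [Balaban1985BackgroundPropagators] (B9 = [5];
`paper:balaban1985-cmp99-background-propagators`, journal page = PDF page + 388): (3.15) p. 393, (3.26) p. 395, (3.35)–(3.37) p. 396 (*«|U(∂p) − 1| < α₀η² …
U with values in the unitary group»*, the smallness of `U` and of the averages `Ū^j`), Thm 3.1 (3.42) p. 397, Thm 3.3 p. 399, Thm 3.11 p. 416 (*«Under the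
assumptions of the Theorems 3.1–3.10 (i.e. for M sufficiently large and α₀ sufficiently small) the operators Δ′_a, G′, (Q′G′²Q′*)⁻¹, Δ_a, G are positive
definite.»*), (3.126) p. 420, (3.132)–(3.133) p. 422, (3.137) p. 423; [Balaban1985Averaging] (B7 = [4]; `paper:balaban1985-cmp98-averaging`, journal page =
PDF page + 16): Prop. 2 (52)–(54) p. 26, (53) p. 26, p. 25 (before (47)), p. 37 (after (127)), (42)–(43) pp. 23–24, (18) p. 21; [Balaban1984PropagatorsII]
(B6) (2.51)–(2.52) p. 232, (2.54) p. 233, Lemma 2.1 (2.61) p. 234.  [5] pp. 396, 416, 420–423 and [15] pp. 306–308 re-read this generation in the held text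
layers; the other loci as printed in the headers of the tree files consumed.

WHY THIS FILE (audit cell `pub-balaban`, BINDER row (D4), OWNER lineage `b2b-balaban-beta-an4`, gen 112; «Y12e»).  «Y5c»
`Beta.RemainderOriginTowerClosed.exists_ineq190_origin_tower` ∕ `exists_hasMaj_H1k_tower` — NODE D at the origin on `Ω_k = T_η` with `∃ (α⋆, B, δ, A′, r₁)`
first — still display, under the `∀`, the cell's MODEL letters of the NE9 crew's (K64) ∕ (FCLK) blocks: the regularity display `αU` of the level averages
`Ū^j` (`hα0`, `hα1`, the onto-threshold `hαL : 50(d+1)·αU_j·L^d ≤ ½`, `hU1`, `hreg`, the summable regime `Σ_{j<n+1} αU_j ≤ A_Q`), the level profile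
`‖Ū^j(b) − 1‖ ≤ ε_j ≤ αϱ^j`, the memberships `U(b), Ū^j(b) ∈ U1`, unitarity as `star U(b) = U(b)⁻¹`, contractive transporters `hRlev`, and the positivity
witnesses `hpos′` (of `Δ′_{a′,k}(U)`, [5] Thm 3.1's site operator) and `hpos` (of `Δ_{a,k}(U)`, Thm 3.3's bond operator WITH the Hessian's curvature part) —
[5] Thm 3.11.  ON PRINT's CLASS every one of them is a tree theorem: the LEVEL PROFILE by ne9-leaf-03's AREA count
`B7Eq43AveragedSmallnessLevelFree.exists_profile_of_windows_eta` (`r = 1∕L`); the unitarity of the averages by [4] Prop. 2 (`UlevOf_mem` at the `AvgClosed`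
subgroup `unitaryUnits`); `hRlev` by `B9Eq342GreenPrimeSupBound.norm_adTransportW_eq`; `hRS` by `B9Eq310HessianHermitian.adTransportW_adjoint`; the
REGULARITY DISPLAY by ne9-leaf-02's `B9Eq315QTowerRegularityDisplay` road — HERE with the junk-depth bound `αU_j ≤ α_T = 32(d+1)(d+4)L²α_P` EXPORTED
(`exists_reg_profile_le`, the one line memo `FLAT-LETTERS-LOCATED.md` §21 (iv) recorded as missing for a print's-class `hαL`), so that the onto-threshold of
`Q_k(U)` is a SMALLNESS OF THE PLAQUETTE WINDOW (`3200(d+1)²(d+4)L^{d+2}α_P ≤ 1`) and the summable regime is the geometric sum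
`Σ_{j<n+1} αU_j ≤ 16(d+1)(d+4)c₂′(d,L)`; the positivity of the BOND operator by the NE9 OWNER's `B9Thm311LaplaceAkPositiveDiagonal.exists_laplaceAk_pos_diagonal_closed`
and of the SITE operator by `B9Thm311SitePrimeFormCoerciveTowerCanonical.exists_strong_site_coercive_tower_diagonal` — both `∃ α₀` BEFORE the height.
The predecessor file «Y12a» `Beta.RemainderHasMajH1kTowerPlaquette` composes them into the binder list (`exists_reg_profile_le`, `letters_of_windows`) and
lands the `Δ⁽²⁾`-free half; «Y12b» `Beta.RemainderOriginTowerPlaquette` is the value line's END on print's class.  THIS FILE is the SLICE-GRADIENT LINE's END («Y11» `Beta.RemainderOriginTowerSliceGradClosed.exists_ineq190_sliceGrad_origin_tower`: `hEG0` = «Y9»∘(E2), left entry `E = D_U∘(·)_μ`, every `μ`) on print's class, by the same mechanism: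
* **`exists_ineq190_sliceGrad_origin_tower_plaquette`** — «Y11»'s conclusion (`∃ (α⋆, B, δ₀, B_E, A′, r₁)` first; for every `μ`: `G′`, `(Q_kG′Q_k†)⁻¹`
  constructed two-sided; `∀ δ″, δ″∕8 ≤ ρ → Ineq190 S^{coarse}_m S^{fine bonds, b₊}_m ((D_U∘(·)_μ)ᵉ ∘ (H₀ + G̃Δ⁽²⁾H₀)) (A₀ᴱ + B_G̃ᴱθ_Dc) δ″`) behind `∃ αU hα1 hαL hU1 hreg hpos`, with ONLY print's three windows, the weights, the
  rates, `Δ⁽²⁾`'s displayed local majorant ((3.137); NODE-O-class identification NOT done) and the two smallnesses in `λ` under the `∀`; the summable-regime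
  letter `A_Q` is any number `≥ 16(d+1)(d+4)c₂′(d,L)` fixed with the Hilbert-structure letters BEFORE the `∃`.
Mechanism: «Y11» `exists_ineq190_sliceGrad_origin_tower` at `ϱ := 1∕L` and the caller's `A_Q`; «Y12a»'s `letters_of_windows`; the two Thm 3.11 theorems at `r := 1∕L`; `A := min(α⋆_{Y5c}, α₀^{bond}, α₀^{site})`; [4] Prop. 2's
window CHOSEN INSIDE as `α_P = 2α⋆`, `α⋆ = min(min(1∕(6C₀), c₂′∕8), min(1∕(2·3200(d+1)²(d+4)L^{d+2}), A∕(4K+1)))`, `K = 256(d+1)(d+4)`; the common smallness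
`α″ = α + 2Kα⋆ ≤ A`; threshold `min(A∕2, α⋆)`.

HONEST SCOPE.  [folklore] bookkeeping BY NAME over the NE9 cell's theorems and «Y5c»; NO estimate of [5], [15] or [4] is proved here; constants are the cell's
crude ones.  What stays DISPLAYED is print's (3.35)–(3.36) read GLOBALLY on the torus (the fine-bond and bond-gradient windows are NOT derived from the
plaquette window: non-contractible holonomies — print's statement is per cube, Lemma 3.1 ∕ [4] (44)–(47), «the gauge question» as in the cell's `…TwoWindows`
files), the weight normalisation `ρ_w`, the Hilbert-structure letters (`φ`, `τ`), `Δ⁽²⁾`'s local majorant and the two smallnesses.  Nothing identifies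
Bałaban's step-`k` objects with tree terms beyond NE9's tower (NODE O ∕ A FROZEN (0); the multi-level `{Ω_j}` case untouched).  Row (D4) class UNCHANGED
(instance 0∕1; D4 DISCHARGE NO DATE); NOT B12 Thm 2, NOT BetaPertH, NOT continuum, NOT Clay.  HONEST DEPENDENCY (cell line): continuum YM on T⁴ ⇐ BetaPertH ∧
nine spine estimates (0/9 proved); BetaPertH ⇐ (D1) ∧ (D4) ∧ CAP+tail; G-an2-4 gates asym, D1 and NE2/3/4.  NEW file importing «Y12a» and «Y11»; nothing modified; 0 `def`;
standard axioms; no `sorry`; `maxHeartbeats` ×2 on the one theorem (the sixty-binder unification of «Y11»'s END, as «Y10»).  Net new unproved facts: 0.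
-/

noncomputable section

open scoped BigOperators InnerProductSpace ComplexConjugate

namespace Literature.MathematicalPhysics.QuantumFieldTheory.Balaban1983to89.Beta.RemainderOriginTowerSliceGradPlaquette

open B11SectG B11SupSize190
open B4Sect5Torus (TSite tdist tdist_nonneg)
open B4Sect5Proof (latticeConst)
open B5TorusCover (UT)
open B9Thm34Ext (toB6)
open B9Thm37GlueTorus (torusGeom tdist1)
open B9SectCLatticeCarrier (Bond bpos btgt unshift)
open B9Eq311L2Pairing (WL2)
open B9Eq319QprimeTorus (blockCoord)
open B9Eq315QTower (towerP UlevOf)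
open B9Eq315QTorus (perCfg perCfg_apply cornerSite)
open B9Eq316TowerFlatIsOneStep (siteCast towerP_eq_fineP_pow)
open B7Prop1Explicit (U1 Wcx boxVec)
open B7Prop2Explicit (pdev AvgClosed C0 c2' C0_pos c2'_pos unitaryUnits avgClosed_unitaryUnits unitaryUnits_le_U1)
open B7Eq43AveragedSmallnessLevelFree (UlevOf_mem pdev_perCfg_le_of_plaq exists_profile_of_windows_eta)
open B11Eq44COperatorTower (αT αT_le ulev_mem_U1_of_pdev ulev_reg_of_pdev)
open B9Eq315QTowerRegularityDisplay (profile_le_αT)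
open B9Eq315QTowerRegularityProfile (ulev_reg_geometric)
open B9Eq310DeltaPrime (plaqHolU)
open B9Eq310HessianOperator (adTransportW)
open B9Eq310HessianHermitian (adTransportW_adjoint)
open B11Eq103H1Complex (SiteL2K BondL2K KinvLatticeK covDerivL2K covDivL2K)
open B9Eq326OperatorTower (laplaceAk QkW G1k H1k)
open B9Eq324DeltaPrimeATower (laplacePrimeAk)
open B9Eq342GreenPrimeSupBound (norm_adTransportW_eq)
open B9Eq326OperatorTowerRealityUnitary (star_val_eq_inv_of_mem_unitaryUnits forall_star_eq_inv_of_mem)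
open B9Thm311LaplaceAkPositiveDiagonal (exists_laplaceAk_pos_diagonal_closed)
open B9Thm311SitePrimeFormCoerciveTowerCanonical (exists_strong_site_coercive_tower_diagonal)
open Beta.RemainderOriginTowerSliceGradClosed (exists_ineq190_sliceGrad_origin_tower)
open Beta.RemainderHasMajH1kTowerPlaquette (letters_of_windows)

/-! ## THE SLICE-GRADIENT LINE's END ON PRINT's CLASS, `∃`-first, the model letters derived -/

section Tower

variable {d : ℕ} (hd : 1 ≤ d) (L : ℕ) [NeZero L] (hL : 1 ≤ L) (hL3 : 3 ≤ L)
  {𝔸 : Type*} [CStarAlgebra 𝔸] [Nontrivial 𝔸]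
  {W : Type} [NormedAddCommGroup W] [InnerProductSpace ℂ W] [FiniteDimensional ℂ W] (φ : W ≃ₗ[ℂ] 𝔸)
  {Mφ Mφ' : ℝ} (hMφ : 0 ≤ Mφ) (hMφ' : 0 ≤ Mφ') (hφ : ∀ w, ‖φ w‖ ≤ Mφ * ‖w‖) (hφ' : ∀ X, ‖φ.symm X‖ ≤ Mφ' * ‖X‖)
  {a : ℝ} (ha : 0 < a) {a' : ℝ} (ha' : 0 < a')
  (τ : 𝔸 →ₗ[ℂ] ℂ) {Cτ : ℝ} (hτ : ∀ X, ‖τ X‖ ≤ Cτ * ‖X‖) (hCτ : 0 ≤ Cτ) {Mτ : ℝ} (hτm : ∀ X Y : 𝔸, ‖τ (X * Y)‖ ≤ Mτ * ‖X‖ * ‖Y‖) (hMτ : 0 ≤ Mτ)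
  {ρw : ℝ} (hρw : 0 ≤ ρw)
  (hτ₁ : ∀ X : 𝔸, τ (star X) = conj (τ X)) (hτ₂ : ∀ X Y : 𝔸, τ (X * Y) = τ (Y * X)) (hφτ : ∀ X Y : 𝔸, ⟪φ.symm X, φ.symm Y⟫_ℂ = τ (star X * Y))
  (AQ : ℝ) (hAQ16 : 16 * ((d : ℝ) + 1) * ((d : ℝ) + 4) * c2' d L ≤ AQ)

set_option maxHeartbeats 400000 in
include hd hL hL3 hMφ hMφ' hφ hφ' ha ha' hτ hCτ hτm hMτ hρw hτ₁ hτ₂ hφτ hAQ16 in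
/-- **THE SLICE-GRADIENT LINE OF NODE D AT THE ORIGIN IN A BACKGROUND ON NE9's TOWER — THE END ON PRINT's SMALL-FIELD CLASS (3.35)–(3.36), `∃ (α⋆, B, δ₀, B_E, A′, r₁)`
FIRST, EVERY `μ`** ([15] (182), (190)'s gradient line; [5] (3.3), Thm 3.3's gradient member).  «Y11»
`Beta.RemainderOriginTowerSliceGradClosed.exists_ineq190_sliceGrad_origin_tower` with EVERY structural ∕ positivity letter of its `∀`-block DERIVED on print's class: under the `∀` stay ONLY the height on the diagonal (`ηL^{n+1} = 1`), the weights (`c₀(L^{n+1})^d = c₁`,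
`|η|^d∕c₀ ≤ ρ_w`), the period (`1 ≤ m_i`), a `unitaryUnits`-valued background `U` with the THREE WINDOWS `‖U(b) − 1‖ ≤ αη`, `‖U(∂p) − 1‖ ≤ αη²`,
`‖U(x,μ) − U(x − e_μ,μ)‖ ≤ αη²` for some `0 ≤ α ≤ α⋆`, the geometry, the rates `σ > 0`, `ρ ≥ 0`, `ρ + 5σ ≤ δ∕d`, `ρ + 5σ ≤ r₁∕d` with the row-sum
constant bound to `c₀(1,σ)^d`, `Δ⁽²⁾` DISPLAYED with its local majorant ((3.137): range `r_D`, row and column sums `≤ λ`; NODE-O-class identification NOT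
done), the derived constants bound to their closed forms (`rfl`) and the two smallnesses `q, q_I < 1` in `λ`.  CONCLUSION: THERE ARE a regularity display
`αU` (`αU_j ≤ 1∕64`, `50(d+1)αU_jL^d ≤ ½`, `hU1`, `hreg` — [4] Prop. 2, §1) and a positivity witness `hpos` of `Δ_{a,k}(U)` ([5] Thm 3.11, the NE9 OWNER's
`B9Thm311LaplaceAkPositiveDiagonal.exists_laplaceAk_pos_diagonal_closed`) such that «Y11»'s conclusion holds AT THEM: `G′ = (Δ_{a,k}(U) − Δ⁽²⁾)⁻¹` and
`(Q_kG′Q_k†)⁻¹` CONSTRUCTED two-sided and `∀ δ″, δ″∕8 ≤ ρ → Ineq190 S^{coarse}_m S^{fine bonds, b₊}_m ((D_U∘(·)_μ)ᵉ ∘ (H₀ + G̃Δ⁽²⁾H₀)) (A₀ᴱ + B_G̃ᴱθ_Dc) δ″`,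
`H₀ = (B9Eq326OperatorTower.H1k … αU hα1 hU1 hreg … hαL hpos)ᵉ↾ℝ` (the same map at any other admissible display ∕ witness:
«Y12c» `Beta.RemainderTowerDisplayIrrel.H1k_display_irrel` ∕ `laplaceAk_display_irrel` ∕ `QkW_display_irrel`), `G̃ = G′ − G′Q_k†ᵉ(Q_kG′Q_k†)⁻¹Q_kᵉG′`.  Derivations: the level profile (3.37) by the
AREA count (`B7Eq43AveragedSmallnessLevelFree.exists_profile_of_windows_eta`, `r = 1∕L`), the unitarity of the averages by [4] Prop. 2 (`UlevOf_mem` at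
`unitaryUnits`), `hRlev` (`norm_adTransportW_eq`), `hRS` (`adTransportW_adjoint`), the regularity display with the exported bound `αU_j ≤ α_T` (§1; the
onto-threshold becomes `3200(d+1)²(d+4)L^{d+2}α_P ≤ 1` on [4] Prop. 2's window `α_P`, CHOSEN INSIDE as `2α⋆′`), the summable regime as a geometric sum
(`≤ 16(d+1)(d+4)c₂′ ≤ A_Q`), `hpos′` (the site operator, `exists_strong_site_coercive_tower_diagonal`) and `hpos`; «Y11» is applied at `ϱ := 1∕L` and the
common smallness `α″ = α + 2Kα⋆′ ≤ A = min(α⋆_{Y11}, α₀^{bond}, α₀^{site})`, `K = 256(d+1)(d+4)`,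
`α⋆′ = min(min(1∕(6C₀), c₂′∕8), min(1∕(2·3200(d+1)²(d+4)L^{d+2}), A∕(4K+1)))`, threshold `α⋆ := min(A∕2, α⋆′)`.  What stays displayed is print's
(3.35)–(3.36) read GLOBALLY on the torus (the fine-bond and gradient windows are NOT derived from the plaquette window — non-contractible holonomies), `ρ_w`,
the Hilbert-structure letters, `Δ⁽²⁾`'s majorant and the two smallnesses.
[cite: Balaban1985Variational, (182) p.307, (190) p.308, (129)–(131) pp.297–298, p.306 after (179), (180) p.306]
[cite: Balaban1985BackgroundPropagators, (3.3) p.391, Thm 3.1 (3.42) p.397, Thm 3.3 p.399, Thm 3.11 p.416, (3.35)–(3.37) p.396, (3.15) p.393, (3.126) p.420, (3.132)–(3.133) p.422, (3.137)–(3.138) p.423]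
[cite: Balaban1985Averaging, Prop. 2 (52)–(54) p.26, (42)–(43) pp.23–24, (18) p.21] [cite: Balaban1984PropagatorsII, (2.51)–(2.52) p.232, (2.54) p.233, Lemma 2.1 (2.61) p.234] -/
theorem exists_ineq190_sliceGrad_origin_tower_plaquette :
    ∃ αs B δ BE A' r₁ : ℝ, 0 < αs ∧ 0 ≤ B ∧ 0 < δ ∧ 0 ≤ BE ∧ 0 ≤ A' ∧ 0 < r₁ ∧
      ∀ (n : ℕ) (η : ℝ) (_hηL : η * (L : ℝ) ^ (n + 1) = 1) (c₀ c₁ : ℝ) [Fact (0 < c₀)] [Fact (0 < c₁)]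
        (_hw : c₀ * ((L : ℝ) ^ (n + 1)) ^ d = c₁) (_hρ : |η| ^ d / c₀ ≤ ρw) (m : Fin d → ℕ) [∀ i, NeZero (m i)] (_hm : ∀ i, 1 ≤ m i)
        (U : Bond d (towerP L m (n + 1)) → 𝔸ˣ) (_hUu : ∀ b, U b ∈ unitaryUnits 𝔸)
        (α : ℝ) (_hα : 0 ≤ α) (_hαle : α ≤ αs) (_hUη : ∀ b, ‖(U b : 𝔸) - 1‖ ≤ α * η)
        (_hpl : ∀ p : B9SectCLatticeCarrier.Plaq d (towerP L m (n + 1)), ‖(plaqHolU U p : 𝔸) - 1‖ ≤ α * η ^ 2)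
        (_hUgrad : ∀ (x : TSite d (towerP L m (n + 1))) (μ : Fin d), ‖(U (x, μ) : 𝔸) - U (unshift μ x, μ)‖ ≤ α * η ^ 2)
        (η₀ L₀ M₀ R : ℝ) (H : Prop) (μ : Fin d)
        -- the rates and the (free) row-sum constant
        (ρ σ c : ℝ) (_hσ : 0 < σ) (_hρ0 : 0 ≤ ρ) (_hρ₁ : ρ + 5 * σ ≤ δ / d) (_hρI : ρ + 5 * σ ≤ r₁ / d) (_hc_def : c = B6.c0 1 σ ^ d)
    -- `Δ⁽²⁾` DISPLAYED: a local operator on the fine carrier ((3.137): range `r_D`, row and column sums `≤ λ`)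
    (D2 : BondL2K ℂ d (towerP L m (n + 1)) c₀ W →ₗ[ℂ] BondL2K ℂ d (towerP L m (n + 1)) c₀ W)
    {KD : UT m → UT m → ℝ} {lam rD : ℝ} (hlam : 0 ≤ lam) (hKD : ∀ y v, 0 ≤ KD y v)
    (hDloc : ∀ y v, KD y v ≠ 0 → (toB6 (torusGeom m η₀ L₀ M₀) R H).dist y v ≤ rD)
    (hDrow : ∀ y, ∑ v : UT m, KD y v ≤ lam) (hDcol : ∀ v, ∑ y : UT m, KD y v ≤ lam)
    (hD2 : HasMaj
      (supSize (toB6 (torusGeom m η₀ L₀ M₀) R H)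
        (fun y => Finset.univ.filter fun b : Bond d (towerP L m (n + 1)) =>
          blockCoord (L ^ (n + 1)) m (siteCast (towerP_eq_fineP_pow L m (n + 1)) (bpos b)) = UT.toSite m y)
        (fun b => UT.ofSite m (blockCoord (L ^ (n + 1)) m (siteCast (towerP_eq_fineP_pow L m (n + 1)) (bpos b)))) :
          BlockNorm (toB6 (torusGeom m η₀ L₀ M₀) R H) (Bond d (towerP L m (n + 1)) → W))
      (supSize (toB6 (torusGeom m η₀ L₀ M₀) R H)
        (fun y => Finset.univ.filter fun b : Bond d (towerP L m (n + 1)) =>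
          blockCoord (L ^ (n + 1)) m (siteCast (towerP_eq_fineP_pow L m (n + 1)) (bpos b)) = UT.toSite m y)
        (fun b => UT.ofSite m (blockCoord (L ^ (n + 1)) m (siteCast (towerP_eq_fineP_pow L m (n + 1)) (bpos b)))))
      (((WL2.linearEquiv ℂ ℂ (fun _ : Bond d (towerP L m (n + 1)) => c₀) :
            BondL2K ℂ d (towerP L m (n + 1)) c₀ W ≃ₗ[ℂ] (Bond d (towerP L m (n + 1)) → W)).toLinearMap ∘ₗ D2 ∘ₗ
          (WL2.linearEquiv ℂ ℂ (fun _ : Bond d (towerP L m (n + 1)) => c₀) :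
            BondL2K ℂ d (towerP L m (n + 1)) c₀ W ≃ₗ[ℂ] (Bond d (towerP L m (n + 1)) → W)).symm.toLinearMap).restrictScalars ℝ)
      KD)
    -- the derived constants, bound to their closed forms (instantiate with `rfl`), and the TWO smallnesses in `λ`
    {q BG' θP qI BI' A₀ θD A₀E BEG' BEt : ℝ}
    (hq_def : q = B * lam * Real.exp (δ / d * rD) * c) (hq : q < 1) (hBG' : BG' = B * (1 - q)⁻¹)
    (hθP : θP = B * lam * Real.exp (δ / d * rD) * BG' * c *
      ((Mφ' * Real.exp (100 * d * (d + 1) * (L : ℝ) ^ d * AQ) * Mφ * ((2 * d : ℕ) : ℝ)) * Real.exp 1 * latticeConst d 1) *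
      Real.exp ((ρ + 4 * σ) * d) * ((Mφ' * Mφ * Real.exp (50 * (d + 1) * AQ)) * Real.exp 1 * latticeConst d 1) *
      Real.exp ((ρ + 4 * σ) * d))
    (hqI : qI = A' * θP * c * c) (hqI1 : qI < 1) (hBI' : BI' = A' * (1 - qI)⁻¹)
    (hA₀ : A₀ = B * ((Mφ' * Real.exp (100 * d * (d + 1) * (L : ℝ) ^ d * AQ) * Mφ * ((2 * d : ℕ) : ℝ)) * Real.exp 1 *
      latticeConst d 1) * Real.exp δ * A' * c)
    (hθD : θD = A₀ * lam * Real.exp (ρ * rD))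
    (hA₀E : A₀E = BE * ((Mφ' * Real.exp (100 * d * (d + 1) * (L : ℝ) ^ d * AQ) * Mφ * ((2 * d : ℕ) : ℝ)) * Real.exp 1 * latticeConst d 1) * Real.exp δ * A' * c)
    (hBEG' : BEG' = BE + BE * lam * Real.exp (δ / d * rD) * BG' * c)
    (hBEt : BEt = BEG' + ((Mφ' * Mφ * Real.exp (50 * (d + 1) * AQ)) * Real.exp 1 * latticeConst d 1) *
      ((Mφ' * Real.exp (100 * d * (d + 1) * (L : ℝ) ^ d * AQ) * Mφ * ((2 * d : ℕ) : ℝ)) * Real.exp 1 * latticeConst d 1) *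
      BI' * BEG' * BG' * Real.exp ((ρ + 2 * σ) * d) * Real.exp ((ρ + 2 * σ) * d) * c * c),
      ∃ (αU : ℕ → ℝ) (hα1 : ∀ j, αU j ≤ 1 / 64) (hαL : ∀ j, 50 * (d + 1) * αU j * (L : ℝ) ^ d ≤ 1 / 2)
        (hU1 : ∀ (j : ℕ) (x : B7Prop1Explicit.Site d) (k : Fin d), perCfg (towerP L m (j + 1)) (UlevOf L m (n + 1) U j) x k ∈ U1 𝔸)
        (hreg : ∀ (j : ℕ) (y : TSite d (towerP L m j)) (k : Fin d) (ρ' : Fin d → Fin L),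
          ‖((Wcx L (perCfg (towerP L m (j + 1)) (UlevOf L m (n + 1) U j)) (cornerSite L y) k (boxVec L ρ') : 𝔸ˣ) : 𝔸) - 1‖ ≤ αU j)
        (hpos : ∀ x : BondL2K ℂ d (towerP L m (n + 1)) c₀ W, x ≠ 0 →
          0 < RCLike.re ⟪x, laplaceAk L m n φ η U hL αU hα1 hU1 hreg τ (c₀ := c₀) (c₁ := c₁) a x⟫_ℂ),
    ∃ (G' : (Bond d (towerP L m (n + 1)) → W) →L[ℂ] (Bond d (towerP L m (n + 1)) → W))
      (Inv' : (Bond d m → W) →L[ℂ] (Bond d m → W)),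
      -- `G′ = (Δ_{a,k}(U) − Δ⁽²⁾)⁻¹`, two-sided
      G' * (LinearMap.toContinuousLinearMap
          ((WL2.linearEquiv ℂ ℂ (fun _ : Bond d (towerP L m (n + 1)) => c₀) :
              BondL2K ℂ d (towerP L m (n + 1)) c₀ W ≃ₗ[ℂ] (Bond d (towerP L m (n + 1)) → W)).toLinearMap ∘ₗ
            laplaceAk L m n φ η U hL αU hα1 hU1 hreg τ (c₀ := c₀) (c₁ := c₁) a ∘ₗ
            (WL2.linearEquiv ℂ ℂ (fun _ : Bond d (towerP L m (n + 1)) => c₀) :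
              BondL2K ℂ d (towerP L m (n + 1)) c₀ W ≃ₗ[ℂ] (Bond d (towerP L m (n + 1)) → W)).symm.toLinearMap) -
        LinearMap.toContinuousLinearMap
          ((WL2.linearEquiv ℂ ℂ (fun _ : Bond d (towerP L m (n + 1)) => c₀) :
              BondL2K ℂ d (towerP L m (n + 1)) c₀ W ≃ₗ[ℂ] (Bond d (towerP L m (n + 1)) → W)).toLinearMap ∘ₗ D2 ∘ₗ
            (WL2.linearEquiv ℂ ℂ (fun _ : Bond d (towerP L m (n + 1)) => c₀) :
              BondL2K ℂ d (towerP L m (n + 1)) c₀ W ≃ₗ[ℂ] (Bond d (towerP L m (n + 1)) → W)).symm.toLinearMap)) = 1 ∧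
      (LinearMap.toContinuousLinearMap
          ((WL2.linearEquiv ℂ ℂ (fun _ : Bond d (towerP L m (n + 1)) => c₀) :
              BondL2K ℂ d (towerP L m (n + 1)) c₀ W ≃ₗ[ℂ] (Bond d (towerP L m (n + 1)) → W)).toLinearMap ∘ₗ
            laplaceAk L m n φ η U hL αU hα1 hU1 hreg τ (c₀ := c₀) (c₁ := c₁) a ∘ₗ
            (WL2.linearEquiv ℂ ℂ (fun _ : Bond d (towerP L m (n + 1)) => c₀) :
              BondL2K ℂ d (towerP L m (n + 1)) c₀ W ≃ₗ[ℂ] (Bond d (towerP L m (n + 1)) → W)).symm.toLinearMap) -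
        LinearMap.toContinuousLinearMap
          ((WL2.linearEquiv ℂ ℂ (fun _ : Bond d (towerP L m (n + 1)) => c₀) :
              BondL2K ℂ d (towerP L m (n + 1)) c₀ W ≃ₗ[ℂ] (Bond d (towerP L m (n + 1)) → W)).toLinearMap ∘ₗ D2 ∘ₗ
            (WL2.linearEquiv ℂ ℂ (fun _ : Bond d (towerP L m (n + 1)) => c₀) :
              BondL2K ℂ d (towerP L m (n + 1)) c₀ W ≃ₗ[ℂ] (Bond d (towerP L m (n + 1)) → W)).symm.toLinearMap)) * G' = 1 ∧
      -- `Inv′ = (Q_kG′Q_k†)⁻¹`, two-sided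
      Inv' * ((LinearMap.toContinuousLinearMap
          ((WL2.linearEquiv ℂ ℂ (fun _ : Bond d m => c₁) : BondL2K ℂ d m c₁ W ≃ₗ[ℂ] (Bond d m → W)).toLinearMap ∘ₗ
            QkW L m n φ U hL αU hα1 hU1 hreg (c₀ := c₀) (c₁ := c₁) ∘ₗ
            (WL2.linearEquiv ℂ ℂ (fun _ : Bond d (towerP L m (n + 1)) => c₀) :
              BondL2K ℂ d (towerP L m (n + 1)) c₀ W ≃ₗ[ℂ] (Bond d (towerP L m (n + 1)) → W)).symm.toLinearMap)).comp
        (G'.comp (LinearMap.toContinuousLinearMap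
          ((WL2.linearEquiv ℂ ℂ (fun _ : Bond d (towerP L m (n + 1)) => c₀) :
              BondL2K ℂ d (towerP L m (n + 1)) c₀ W ≃ₗ[ℂ] (Bond d (towerP L m (n + 1)) → W)).toLinearMap ∘ₗ
            LinearMap.adjoint (QkW L m n φ U hL αU hα1 hU1 hreg (c₀ := c₀) (c₁ := c₁)) ∘ₗ
            (WL2.linearEquiv ℂ ℂ (fun _ : Bond d m => c₁) : BondL2K ℂ d m c₁ W ≃ₗ[ℂ] (Bond d m → W)).symm.toLinearMap)))) = 1 ∧
      ((LinearMap.toContinuousLinearMap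
          ((WL2.linearEquiv ℂ ℂ (fun _ : Bond d m => c₁) : BondL2K ℂ d m c₁ W ≃ₗ[ℂ] (Bond d m → W)).toLinearMap ∘ₗ
            QkW L m n φ U hL αU hα1 hU1 hreg (c₀ := c₀) (c₁ := c₁) ∘ₗ
            (WL2.linearEquiv ℂ ℂ (fun _ : Bond d (towerP L m (n + 1)) => c₀) :
              BondL2K ℂ d (towerP L m (n + 1)) c₀ W ≃ₗ[ℂ] (Bond d (towerP L m (n + 1)) → W)).symm.toLinearMap)).comp
        (G'.comp (LinearMap.toContinuousLinearMap
          ((WL2.linearEquiv ℂ ℂ (fun _ : Bond d (towerP L m (n + 1)) => c₀) :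
              BondL2K ℂ d (towerP L m (n + 1)) c₀ W ≃ₗ[ℂ] (Bond d (towerP L m (n + 1)) → W)).toLinearMap ∘ₗ
            LinearMap.adjoint (QkW L m n φ U hL αU hα1 hU1 hreg (c₀ := c₀) (c₁ := c₁)) ∘ₗ
            (WL2.linearEquiv ℂ ℂ (fun _ : Bond d m => c₁) : BondL2K ℂ d m c₁ W ≃ₗ[ℂ] (Bond d m → W)).symm.toLinearMap)))) * Inv' = 1 ∧
      -- the (190) letter of `H₀ + G̃Δ⁽²⁾H₀`, `H₀ = H₁,k(U)` by name, `G̃ = G′ − G′Q_k†·Inv′·Q_kG′`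
      ∀ δ' : ℝ, δ' / 8 ≤ ρ →
        Ineq190
          (supSize (toB6 (torusGeom m η₀ L₀ M₀) R H)
            (fun y => Finset.univ.filter fun c : Bond d m => bpos c = UT.toSite m y)
            (fun c => UT.ofSite m (bpos c)) : BlockNorm (toB6 (torusGeom m η₀ L₀ M₀) R H) (Bond d m → W))
          (supSize (toB6 (torusGeom m η₀ L₀ M₀) R H)
            (fun y => Finset.univ.filter fun b : Bond d (towerP L m (n + 1)) =>
              blockCoord (L ^ (n + 1)) m (siteCast (towerP_eq_fineP_pow L m (n + 1)) (btgt b)) = UT.toSite m y)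
            (fun b => UT.ofSite m (blockCoord (L ^ (n + 1)) m (siteCast (towerP_eq_fineP_pow L m (n + 1)) (btgt b)))) :
              BlockNorm (toB6 (torusGeom m η₀ L₀ M₀) R H) (Bond d (towerP L m (n + 1)) → W))
          ((((WL2.linearEquiv ℂ ℂ (fun _ : Bond d (towerP L m (n + 1)) => c₀) :
                BondL2K ℂ d (towerP L m (n + 1)) c₀ W ≃ₗ[ℂ] (Bond d (towerP L m (n + 1)) → W)).toLinearMap ∘ₗ
              covDerivL2K ℂ c₀ ((η : ℂ))⁻¹ (adTransportW φ U) ∘ₗ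
              (WL2.linearEquiv ℂ ℂ (fun _ : TSite d (towerP L m (n + 1)) => c₀) :
                SiteL2K ℂ d (towerP L m (n + 1)) c₀ W ≃ₗ[ℂ] (TSite d (towerP L m (n + 1)) → W)).symm.toLinearMap ∘ₗ
              (LinearMap.pi fun y : TSite d (towerP L m (n + 1)) =>
                (LinearMap.proj ((y, μ) : Bond d (towerP L m (n + 1))) : (Bond d (towerP L m (n + 1)) → W) →ₗ[ℂ] W))).restrictScalars ℝ) ∘ₗ
          ((((WL2.linearEquiv ℂ ℂ (fun _ : Bond d (towerP L m (n + 1)) => c₀) :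
                  BondL2K ℂ d (towerP L m (n + 1)) c₀ W ≃ₗ[ℂ] (Bond d (towerP L m (n + 1)) → W)).toLinearMap ∘ₗ
              H1k L m n φ η U hL αU hα1 hU1 hreg τ (c₀ := c₀) (c₁ := c₁) hαL hpos ∘ₗ
              (WL2.linearEquiv ℂ ℂ (fun _ : Bond d m => c₁) : BondL2K ℂ d m c₁ W ≃ₗ[ℂ] (Bond d m → W)).symm.toLinearMap).restrictScalars ℝ) +
            ((G'.restrictScalars ℝ : (Bond d (towerP L m (n + 1)) → W) →ₗ[ℝ] (Bond d (towerP L m (n + 1)) → W)) -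
              ((G'.restrictScalars ℝ : (Bond d (towerP L m (n + 1)) → W) →ₗ[ℝ] (Bond d (towerP L m (n + 1)) → W)) ∘ₗ
                (((WL2.linearEquiv ℂ ℂ (fun _ : Bond d (towerP L m (n + 1)) => c₀) :
                      BondL2K ℂ d (towerP L m (n + 1)) c₀ W ≃ₗ[ℂ] (Bond d (towerP L m (n + 1)) → W)).toLinearMap ∘ₗ
                  LinearMap.adjoint (QkW L m n φ U hL αU hα1 hU1 hreg (c₀ := c₀) (c₁ := c₁)) ∘ₗ
                  (WL2.linearEquiv ℂ ℂ (fun _ : Bond d m => c₁) : BondL2K ℂ d m c₁ W ≃ₗ[ℂ] (Bond d m → W)).symm.toLinearMap).restrictScalars ℝ)) ∘ₗ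
              (Inv'.restrictScalars ℝ : (Bond d m → W) →ₗ[ℝ] (Bond d m → W)) ∘ₗ
              ((((WL2.linearEquiv ℂ ℂ (fun _ : Bond d m => c₁) : BondL2K ℂ d m c₁ W ≃ₗ[ℂ] (Bond d m → W)).toLinearMap ∘ₗ
                  QkW L m n φ U hL αU hα1 hU1 hreg (c₀ := c₀) (c₁ := c₁) ∘ₗ
                  (WL2.linearEquiv ℂ ℂ (fun _ : Bond d (towerP L m (n + 1)) => c₀) :
                    BondL2K ℂ d (towerP L m (n + 1)) c₀ W ≃ₗ[ℂ] (Bond d (towerP L m (n + 1)) → W)).symm.toLinearMap).restrictScalars ℝ) ∘ₗ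
                (G'.restrictScalars ℝ : (Bond d (towerP L m (n + 1)) → W) →ₗ[ℝ] (Bond d (towerP L m (n + 1)) → W)))) ∘ₗ
            ((((WL2.linearEquiv ℂ ℂ (fun _ : Bond d (towerP L m (n + 1)) => c₀) :
                    BondL2K ℂ d (towerP L m (n + 1)) c₀ W ≃ₗ[ℂ] (Bond d (towerP L m (n + 1)) → W)).toLinearMap ∘ₗ D2 ∘ₗ
                (WL2.linearEquiv ℂ ℂ (fun _ : Bond d (towerP L m (n + 1)) => c₀) :
                  BondL2K ℂ d (towerP L m (n + 1)) c₀ W ≃ₗ[ℂ] (Bond d (towerP L m (n + 1)) → W)).symm.toLinearMap).restrictScalars ℝ) ∘ₗ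
              (((WL2.linearEquiv ℂ ℂ (fun _ : Bond d (towerP L m (n + 1)) => c₀) :
                    BondL2K ℂ d (towerP L m (n + 1)) c₀ W ≃ₗ[ℂ] (Bond d (towerP L m (n + 1)) → W)).toLinearMap ∘ₗ
                H1k L m n φ η U hL αU hα1 hU1 hreg τ (c₀ := c₀) (c₁ := c₁) hαL hpos ∘ₗ
                (WL2.linearEquiv ℂ ℂ (fun _ : Bond d m => c₁) : BondL2K ℂ d m c₁ W ≃ₗ[ℂ] (Bond d m → W)).symm.toLinearMap).restrictScalars ℝ))))
          (A₀E + BEt * θD * c) δ' := by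
  have hL2 : 2 ≤ L := le_trans (by norm_num) hL3
  have hL1r : (1 : ℝ) ≤ L := by exact_mod_cast hL
  have hL0 : (0 : ℝ) < L := lt_of_lt_of_le one_pos hL1r
  have hr0 : (0 : ℝ) ≤ 1 / (L : ℝ) := by positivity
  have hr1 : 1 / (L : ℝ) < 1 := by
    rw [div_lt_one hL0]; exact_mod_cast (lt_of_lt_of_le (by norm_num) hL3 : 1 < L)
  have hstar : ∀ X : 𝔸, ‖star X‖ ≤ ‖X‖ := fun X => (norm_star X).le
  obtain ⟨αs, B, δ, BE, A', r₁, hαs, hB, hδ, hBE, hA', hr₁, HY⟩ :=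
    exists_ineq190_sliceGrad_origin_tower hd L hL hL3 φ hMφ hMφ' hφ hφ' hstar ha ha' hr0 hr1 τ hτ hCτ hτm hMτ hρw hτ₁ hτ₂ hφτ AQ
  -- [5] Thm 3.11 on the diagonal, `∃ α₀` first: the bond operator WITH curvature (the NE9 OWNER's) and the site operator
  obtain ⟨αB, hαB, HB⟩ := exists_laplaceAk_pos_diagonal_closed L hL φ hMφ hMφ' hφ hφ' ha hr0 hr1 τ hτ hCτ hρw
  obtain ⟨αS, γS, hαS, hγS, HS⟩ := exists_strong_site_coercive_tower_diagonal L φ (a' := a') hMφ hMφ' hφ hφ' ha' hr0 hr1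
  -- the constants: the profile slack `K`, the common threshold `A`, the onto-threshold size `P_L`, [4] Prop. 2's window `α_P = 2α⋆′`
  obtain ⟨K, hK0, hKdef⟩ : ∃ K : ℝ, 0 ≤ K ∧ K = 256 * ((d : ℝ) + 1) * ((d : ℝ) + 4) := ⟨_, by positivity, rfl⟩
  obtain ⟨A, hA0, hAdef⟩ : ∃ A : ℝ, 0 < A ∧ A = min (min αs αB) αS := ⟨_, lt_min (lt_min hαs hαB) hαS, rfl⟩
  have hC0 : 0 < C0 d := C0_pos d
  have hc2 : 0 < c2' d L := c2'_pos d L hL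
  obtain ⟨PL, hPL0, hPLdef⟩ : ∃ PL : ℝ, 0 < PL ∧ PL = 3200 * ((d : ℝ) + 1) ^ 2 * ((d : ℝ) + 4) * (L : ℝ) ^ (d + 2) :=
    ⟨_, by positivity, rfl⟩
  obtain ⟨αt, hαt0, hαtdef⟩ : ∃ αt : ℝ, 0 < αt ∧
      αt = min (min (1 / (6 * C0 d)) (c2' d L / 8)) (min (1 / (2 * PL)) (A / (4 * K + 1))) :=
    ⟨_, lt_min (lt_min (by positivity) (by positivity)) (lt_min (by positivity) (by positivity)), rfl⟩
  have hαt1 : αt ≤ 1 / (6 * C0 d) := by rw [hαtdef]; exact (min_le_left _ _).trans (min_le_left _ _)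
  have hαt2 : αt ≤ c2' d L / 8 := by rw [hαtdef]; exact (min_le_left _ _).trans (min_le_right _ _)
  have hαt3 : αt ≤ 1 / (2 * PL) := by rw [hαtdef]; exact (min_le_right _ _).trans (min_le_left _ _)
  have hαt4 : αt ≤ A / (4 * K + 1) := by rw [hαtdef]; exact (min_le_right _ _).trans (min_le_right _ _)
  have hαP : 0 < 2 * αt := by positivity
  have hαP3 : C0 d * (2 * αt) ≤ 1 / 3 := by
    have h1 : C0 d * αt ≤ C0 d * (1 / (6 * C0 d)) := mul_le_mul_of_nonneg_left hαt1 hC0.le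
    have h2 : C0 d * (1 / (6 * C0 d)) = 1 / 6 := by field_simp
    linarith
  have hαP4 : 4 * (2 * αt) ≤ c2' d L := by linarith
  have hαPL : 3200 * ((d : ℝ) + 1) ^ 2 * ((d : ℝ) + 4) * (L : ℝ) ^ (d + 2) * (2 * αt) ≤ 1 := by
    rw [← hPLdef]
    have h1 : PL * (2 * αt) ≤ PL * (2 * (1 / (2 * PL))) := mul_le_mul_of_nonneg_left (by linarith) hPL0.le
    have h2 : PL * (2 * (1 / (2 * PL))) = 1 := by field_simp
    linarith
  have hKαt : (4 * K + 1) * αt ≤ A := by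
    have h := mul_le_mul_of_nonneg_left hαt4 (by positivity : (0 : ℝ) ≤ 4 * K + 1)
    rwa [mul_div_cancel₀ _ (by positivity : (4 * K + 1 : ℝ) ≠ 0)] at h
  refine ⟨min (A / 2) αt, B, δ, BE, A', r₁, lt_min (by positivity) hαt0, hB, hδ, hBE, hA', hr₁, ?_⟩
  intro n η hηL c₀ c₁ _ _ hw hρ m _ hm U hUu α hα hαle hUη hpl hUgrad η₀ L₀ M₀ R H μ ρ σ c hσ hρ0 hρ₁ hρI hc_def D2 KD lam rD hlam hKD
    hDloc hDrow hDcol hD2 q BG' θP qI BI' A₀ θD A₀E BEG' BEt hq_def hq hBG' hθP hqI hqI1 hBI' hA₀ hθD hA₀E hBEG' hBEt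
  have hαA : α ≤ A / 2 := hαle.trans (min_le_left _ _)
  have hααt : α ≤ αt := hαle.trans (min_le_right _ _)
  have hαlt : α < 2 * αt := by linarith only [hααt, hαt0]
  have hηpos : 0 < η := by
    have : η = ((L : ℝ) ^ (n + 1))⁻¹ := (inv_eq_of_mul_eq_one_left hηL).symm
    rw [this]; positivity
  obtain ⟨αU, εU, hαU0, hα1, hαL, hU1, hreg, hAQs, hεU, hLε, hLb, hεg, hUst, hUb, hRlev, hRS⟩ :=
    letters_of_windows L m n φ τ hτ₂ hφτ hL3 hUu hαP hαP3 hαP4 hαPL hηL hα hαlt hUη hpl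
  -- the common smallness `α″ = α + 2Kα⋆′ ≤ A`
  have hα''A : α + 2 * K * αt ≤ A := by linarith only [hαA, hKαt, hαt0.le, mul_nonneg hK0 hαt0.le]
  have hα''0 : 0 ≤ α + 2 * K * αt := by positivity
  have hα''s : α + 2 * K * αt ≤ αs := hα''A.trans (by rw [hAdef]; exact (min_le_left _ _).trans (min_le_left _ _))
  have hα''B : α + 2 * K * αt ≤ αB := hα''A.trans (by rw [hAdef]; exact (min_le_left _ _).trans (min_le_right _ _))
  have hα''S : α + 2 * K * αt ≤ αS := hα''A.trans (by rw [hAdef]; exact min_le_right _ _)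
  have hαle'' : α ≤ α + 2 * K * αt := le_add_of_nonneg_right (by positivity)
  have hUη'' : ∀ b, ‖(U b : 𝔸) - 1‖ ≤ (α + 2 * K * αt) * η := fun b =>
    (hUη b).trans (mul_le_mul_of_nonneg_right hαle'' hηpos.le)
  have hpl'' : ∀ p : B9SectCLatticeCarrier.Plaq d (towerP L m (n + 1)), ‖(plaqHolU U p : 𝔸) - 1‖ ≤ (α + 2 * K * αt) * η ^ 2 := fun p =>
    (hpl p).trans (mul_le_mul_of_nonneg_right hαle'' (sq_nonneg η))
  have hUgrad'' : ∀ (x : TSite d (towerP L m (n + 1))) (μ : Fin d), ‖(U (x, μ) : 𝔸) - U (unshift μ x, μ)‖ ≤ (α + 2 * K * αt) * η ^ 2 :=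
    fun x μ => (hUgrad x μ).trans (mul_le_mul_of_nonneg_right hαle'' (sq_nonneg η))
  have hK2 : α + 256 * ((d : ℝ) + 1) * ((d : ℝ) + 4) * (2 * αt) = α + 2 * K * αt := by rw [hKdef]; ring
  have hεg'' : ∀ j < n + 1, εU j ≤ (α + 2 * K * αt) * (1 / (L : ℝ)) ^ j := fun j hj => by
    have h := hεg j hj
    rwa [hK2] at h
  have hAQ' : ∑ j ∈ Finset.range (n + 1), αU j ≤ AQ := hAQs.trans hAQ16
  -- the two positivity witnesses at `α″`
  have hpos : ∀ x : BondL2K ℂ d (towerP L m (n + 1)) c₀ W, x ≠ 0 →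
      0 < RCLike.re ⟪x, laplaceAk L m n φ η U hL αU hα1 hU1 hreg τ (c₀ := c₀) (c₁ := c₁) a x⟫_ℂ := fun x hx =>
    HB n η hηL c₀ c₁ hw hρ m U αU hα1 hU1 hreg εU hεU hLε hα''0 hα''B hRS hUb hUη'' hpl'' hεg'' x hx
  have hpos' : ∀ x : SiteL2K ℂ d (towerP L m (n + 1)) c₀ W, x ≠ 0 → 0 < RCLike.re ⟪x, laplacePrimeAk L m n φ η U a' (c₁ := c₁) x⟫_ℂ := by
    intro x hx
    have key := HS n η hηL c₀ c₁ hw m U hRS (α + 2 * K * αt) hα''0 hα''S hUb hUη'' εU hεU hεg'' hLε hLb x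
    have hx2 : 0 < ‖x‖ ^ 2 := by positivity
    have hp : 0 < γS * (‖covDerivL2K ℂ c₀ ((η : ℂ))⁻¹ (adTransportW φ (fun _ : Bond d (towerP L m (n + 1)) => (1 : 𝔸ˣ))) x‖ ^ 2 + ‖x‖ ^ 2) :=
      mul_pos hγS (add_pos_of_nonneg_of_pos (sq_nonneg _) hx2)
    exact hp.trans_le key
  refine ⟨αU, hα1, hαL, hU1, hreg, hpos, ?_⟩
  exact HY n η hηL c₀ c₁ hw hρ m hm U αU hαU0 hα1 hαL hU1 hreg εU hεU hLε hLb (α + 2 * K * αt) hα''0 hα''s hUst hUb hUη'' hpl'' hUgrad''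
    hRlev hεg'' hAQ' hpos' hpos η₀ L₀ M₀ R H μ ρ σ c hσ hρ0 hρ₁ hρI hc_def D2 hlam hKD hDloc hDrow hDcol hD2 hq_def hq hBG' hθP hqI hqI1 hBI'
    hA₀ hθD hA₀E hBEG' hBEt

end Tower

end Literature.MathematicalPhysics.QuantumFieldTheory.Balaban1983to89.Beta.RemainderOriginTowerSliceGradPlaquette

end
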